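import Summits.NavierStokesRegularity.NavierStokesRegularity.Theorems.FastClassSqueeze.Negative.FalseWithoutLerayHopf

/-!
# `SlowClassProduction` is false outside the energy class (the energy-class hypotheses are load-bearing)

Negative-side support for the crux `SlowClassProduction` (stmt-NavierStokesRegularity-15831, route
`HodographBetchov`, rank 2), prover seat 1 (escalated), 2026-08-17. Theorems and an explicit witness only;
nothing here asserts a Theses statement.

The crux says: along every classical solution `(u, p)` of unforced Navier–Stokes on `ℝ³ × [0,T)` that is
Leray–Hopf from a rapidly decaying datum, for every speed level `l > 0` the enstrophy production
`ω·(∇u)ω` is integrable on the slow space–time class `{0 < s < t, |u(s,x)| ≤ l}` with integral bounded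
uniformly in `t < T`.

`slowClassProduction_false_without_energyClass`: with the two energy-class hypotheses
`IsLerayHopfOn T ν 0 (u 0) u` and `HasRapidSpatialDecay (u 0)` deleted — and nothing else changed — the
statement is FALSE, and it fails already at the level of INTEGRABILITY, at every positive time.
Witness (`ν = T = l = 1`, any viscosity works): the vortex-stretching stagnation-line flow
`u(t, x) = (−x₀, 2eᵗ x₀, x₂)`, `p = −(x₀² + x₂²)/2` (an exact solution with linear velocity field,
Majda–Bertozzi 2002 §1.4: `∂ₜM + M²` symmetric; here `∂ₜM + M² = diag(1, 0, 1)`). It is a plane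
hyperbolic strain (compression along `e₀`, stretching along `e₂`) carrying the uniform vorticity
`ω = 2eᵗ e₂` ALONG THE STRETCHING AXIS (`curl_lineVel`), so the production density is the positive constant
`ω·(∇u)ω = 4e^{2t}` (`production_lineVel`), while `u` vanishes identically on the neutral `x₁`-axis: the slow
class `{|u(t)| ≤ 1}` is a solid elliptic cylinder around that STAGNATION LINE, of infinite volume
(`volume_iUnion_ball_eq_top`, `ball_subset_slowSlice`), so `ω·(∇u)ω ∉ L¹` of the slow class on `(0, t) × ℝ³`
for every `t > 0`.

Information for provers/planners: (i) the witness realises exactly the enemy named in the item's docstring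
("a strained near-stagnant collar: degenerate stagnation LINE … G²·l·Area → ∞"): a rank-two velocity gradient
with kernel along a line and vorticity along the stretching direction has production density bounded away
from `0` on the whole slow tube, and only the finite length of such lines / the decay of `∇u` along them —
i.e. the ENERGY CLASS — can make the slow-class production finite; any proof must use finite energy
quantitatively (compare `FastClassSqueeze.Negative.fastClassSqueeze_false_without_lerayHopf`, where the energy
class enters through `|{|u| > l}| ≤ 2E₀/l²`; on the slow side there is no such measure bound at all — the slow
class of a finite-energy field always has infinite volume — so what the energy class must supply is decay of
the production density on the slow class, `∇u ∈ L²` and `∇u(t) ∈ L³` slice-wise). (ii) Single-hypothesis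
deletions are out of reach of linear witnesses: a linear flow from rest (`u(0) = 0`, which would keep the
decaying-datum hypothesis, as in the `FastClassSqueeze` negative) is irrotational for all time, because for
`u = (S(t) + [w(t)]ₓ) x` the Navier–Stokes equations reduce to `ẇ = S w`; so it has zero production.
(iii) By contrast, in the energy class the integrability half of the conclusion is automatic for `t < T`
(`∇u(s) ∈ L³` uniformly on compact sub-intervals), and the content of the crux is the uniformity in `t ↑ T`.
[cite: MajdaBertozzi2002, §1.4 (exact solutions with linear velocity field)]
-/

noncomputable section

namespace Summit.NavierStokesRegularity.NavierStokesRegularity.Theorems.SlowClassProduction.Negative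

open MeasureTheory Set Filter Metric InnerProductSpace
open scoped ENNReal RealInnerProductSpace ContDiff Laplacian
open Literature.Analysis.FluidPDE
open Summit.NavierStokesRegularity.NavierStokesRegularity.Theorems.FastClassSqueeze.Negative
  (ex ey ez laplacian_clm)

local notation "ℝ³" => EuclideanSpace ℝ (Fin 3)

/-! ## The linear maps `M_b x = (−x₀, 2b x₀, x₂)` -/

/-- The one-parameter family of trace-free linear maps `M_b x = x₀ (−e₀ + 2b e₁) + x₂ e₂ = (−x₀, 2b x₀, x₂)`;
the kernel of every `M_b` is the `x₁`-axis and `M_b e₂ = e₂`. -/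
def linM (b : ℝ) : ℝ³ →L[ℝ] ℝ³ :=
  (innerSL ℝ ex).smulRight (-ex + (2 * b) • ey) + (innerSL ℝ ez).smulRight ez

/-- `M_b x = x₀ (−e₀ + 2b e₁) + x₂ e₂`. [folklore] -/
theorem linM_apply (b : ℝ) (x : ℝ³) : linM b x = (x 0) • (-ex + (2 * b) • ey) + (x 2) • ez := by
  simp [linM, ex, ez, ContinuousLinearMap.smulRight_apply, EuclideanSpace.inner_single_left]

/-- Coordinates of `M_b x = (−x₀, 2b x₀, x₂)`. [folklore] -/
@[simp] theorem linM_apply_zero (b : ℝ) (x : ℝ³) : linM b x 0 = -x 0 := by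
  simp [linM_apply, ex, ey, ez]

/-- Coordinates of `M_b x = (−x₀, 2b x₀, x₂)`. [folklore] -/
@[simp] theorem linM_apply_one (b : ℝ) (x : ℝ³) : linM b x 1 = 2 * b * x 0 := by
  simp [linM_apply, ex, ey, ez]
  ring

/-- Coordinates of `M_b x = (−x₀, 2b x₀, x₂)`. [folklore] -/
@[simp] theorem linM_apply_two (b : ℝ) (x : ℝ³) : linM b x 2 = x 2 := by
  simp [linM_apply, ex, ey, ez]

/-- `M_b e₂ = e₂`: the vorticity direction is the stretching eigendirection. [folklore] -/
theorem linM_ez (b : ℝ) : linM b ez = ez := by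
  rw [linM_apply]
  simp [ez]

/-- `M_b (M_b x) = x₀ (e₀ − 2b e₁) + x₂ e₂`. [folklore] -/
theorem linM_linM (b : ℝ) (x : ℝ³) : linM b (linM b x) = (x 0) • (ex - (2 * b) • ey) + (x 2) • ez := by
  ext i
  fin_cases i <;> simp [linM_apply, ex, ey, ez]

/-! ## The stagnation-line flow `u(t, x) = (−x₀, 2eᵗ x₀, x₂)` -/

/-- The velocity `u(t, x) = M_{eᵗ} x = (−x₀, 2eᵗ x₀, x₂)`: divergence free, harmonic, vanishing on the
`x₁`-axis, vorticity `2eᵗ e₂`. -/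
def lineVel : ℝ → ℝ³ → ℝ³ := fun t x => linM (Real.exp t) x

/-- The (time-independent) pressure `p(x) = −(x₀² + x₂²)/2` (`= −½ xᵀ(Ṁ + M²)x`, `Ṁ + M² = diag(1, 0, 1)`). -/
def linePres : ℝ → ℝ³ → ℝ := fun _ x => -(1 / 2 : ℝ) * ((x 0) ^ 2 + (x 2) ^ 2)

/-- The time slices of the flow are the linear maps `M_{eᵗ}`. [folklore] -/
theorem lineVel_eq (t : ℝ) : lineVel t = ⇑(linM (Real.exp t)) := rfl

/-- `∇u(t) ≡ M_{eᵗ}`. [folklore] -/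
theorem fderiv_lineVel (t : ℝ) (x : ℝ³) : fderiv ℝ (lineVel t) x = linM (Real.exp t) := by
  rw [lineVel_eq, ContinuousLinearMap.fderiv]

/-- `‖u(t, x)‖² = (1 + 4e^{2t}) x₀² + x₂²` — independent of `x₁`. [folklore] -/
theorem norm_sq_lineVel (t : ℝ) (x : ℝ³) :
    ‖lineVel t x‖ ^ 2 = (1 + 4 * Real.exp t ^ 2) * (x 0) ^ 2 + (x 2) ^ 2 := by
  rw [EuclideanSpace.norm_eq, Real.sq_sqrt (Finset.sum_nonneg fun i _ => sq_nonneg _),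
    Fin.sum_univ_three]
  simp only [Real.norm_eq_abs, sq_abs, lineVel, linM_apply_zero, linM_apply_one, linM_apply_two]
  ring

/-- **Vorticity along the stretching axis**: `curl u(t) ≡ 2eᵗ e₂`. [folklore] -/
theorem curl_lineVel (t : ℝ) (x : ℝ³) : curl (lineVel t) x = (2 * Real.exp t) • ez := by
  simp only [curl, fderiv_lineVel]
  ext i
  fin_cases i <;> simp [ez]

/-- **Constant positive production density**: `ω·(∇u)ω = 4e^{2t}` everywhere. [folklore] -/
theorem production_lineVel (t : ℝ) (x : ℝ³) :
    ⟪curl (lineVel t) x, fderiv ℝ (lineVel t) x (curl (lineVel t) x)⟫ = 4 * Real.exp t ^ 2 := by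
  rw [curl_lineVel, fderiv_lineVel, map_smul, linM_ez, real_inner_smul_left, real_inner_smul_right,
    real_inner_self_eq_norm_sq]
  simp [ez]
  ring

/-- The derivative of the quadratic pressure. [folklore] -/
theorem hasFDerivAt_linePres (t : ℝ) (x : ℝ³) :
    HasFDerivAt (linePres t)
      ((-(1 / 2 : ℝ)) • ((2 • (x 0) ^ (2 - 1)) • (EuclideanSpace.proj 0 : ℝ³ →L[ℝ] ℝ) +
          (2 • (x 2) ^ (2 - 1)) • (EuclideanSpace.proj 2 : ℝ³ →L[ℝ] ℝ))) x := by
  have h0 : HasFDerivAt (fun y : ℝ³ => y 0) (EuclideanSpace.proj 0 : ℝ³ →L[ℝ] ℝ) x :=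
    PiLp.hasFDerivAt_apply 2 x 0
  have h2 : HasFDerivAt (fun y : ℝ³ => y 2) (EuclideanSpace.proj 2 : ℝ³ →L[ℝ] ℝ) x :=
    PiLp.hasFDerivAt_apply 2 x 2
  exact ((h0.pow 2).add (h2.pow 2)).const_mul _

/-- `∇p(x) = −x₀ e₀ − x₂ e₂`. [folklore] -/
theorem gradient_linePres (t : ℝ) (x : ℝ³) :
    gradient (linePres t) x = (-(x 0)) • ex + (-(x 2)) • ez := by
  have hP : HasFDerivAt (linePres t)
      (InnerProductSpace.toDual ℝ ℝ³ ((-(x 0)) • ex + (-(x 2)) • ez)) x := by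
    refine (hasFDerivAt_linePres t x).congr_fderiv (ContinuousLinearMap.ext fun h => ?_)
    simp only [add_apply, FunLike.coe_smul, Pi.smul_apply,
      InnerProductSpace.toDual_apply_apply, inner_add_left, inner_smul_left, ex, ez,
      EuclideanSpace.inner_single_left, smul_eq_mul, map_one, one_mul, conj_trivial, pow_one,
      Nat.add_one_sub_one, nsmul_eq_mul, Nat.cast_ofNat, PiLp.proj_apply]
    ring
  exact (hasGradientAt_iff_hasFDerivAt.mpr hP).gradient

/-- `div u(t) = tr M_{eᵗ} = −1 + 0 + 1 = 0`. [folklore] -/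
theorem divergence_lineVel (t : ℝ) (x : ℝ³) : VectorCalculus.divergence (lineVel t) x = 0 := by
  rw [divergence_eq_sum_inner_fderiv (EuclideanSpace.basisFun (Fin 3) ℝ), fderiv_lineVel,
    Fin.sum_univ_three]
  simp only [EuclideanSpace.basisFun_apply, EuclideanSpace.inner_single_left, map_one, one_mul,
    linM_apply_zero, linM_apply_one, linM_apply_two, PiLp.single_apply]
  simp

/-- **The stagnation-line flow is a classical solution** of unforced Navier–Stokes on `[0, 1) × ℝ³`, for
every viscosity: `∂ₜu = 2eᵗ x₀ e₁`, `(u·∇)u = M² x = x₀ e₀ − 2eᵗ x₀ e₁ + x₂ e₂`, `Δu = 0`,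
`−∇p = x₀ e₀ + x₂ e₂`, `div u = 0` (Majda–Bertozzi 2002, §1.4: `u = M(t) x` solves NS iff `Ṁ + M²` is
symmetric and `tr M = 0`; here `Ṁ + M² = diag(1, 0, 1)`).
[cite: MajdaBertozzi2002, §1.4 (exact solutions with linear velocity field)] -/
theorem lineVel_isClassical (ν : ℝ) : IsClassicalNSSolutionOn (Ico 0 1) ν 0 lineVel linePres where
  smooth_velocity := by
    show ContDiffOn ℝ ∞ (fun z : ℝ × ℝ³ => linM (Real.exp z.1) z.2) (Ico 0 1 ×ˢ univ)
    have hfun : (fun z : ℝ × ℝ³ => linM (Real.exp z.1) z.2) =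
        fun z => (z.2 0) • (-ex + (2 * Real.exp z.1) • ey) + (z.2 2) • ez :=
      funext fun z => linM_apply _ _
    rw [hfun]
    have ht : ContDiff ℝ ∞ (fun z : ℝ × ℝ³ => Real.exp z.1) := Real.contDiff_exp.comp contDiff_fst
    have h0 : ContDiff ℝ ∞ (fun z : ℝ × ℝ³ => z.2 0) :=
      (contDiff_piLp_apply (p := 2) (i := (0 : Fin 3))).comp contDiff_snd
    have h2 : ContDiff ℝ ∞ (fun z : ℝ × ℝ³ => z.2 2) :=
      (contDiff_piLp_apply (p := 2) (i := (2 : Fin 3))).comp contDiff_snd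
    exact ((h0.smul (contDiff_const.add ((contDiff_const.mul ht).smul contDiff_const))).add
      (h2.smul contDiff_const)).contDiffOn
  smooth_pressure := by
    show ContDiffOn ℝ ∞ (fun z : ℝ × ℝ³ => -(1 / 2 : ℝ) * ((z.2 0) ^ 2 + (z.2 2) ^ 2)) (Ico 0 1 ×ˢ univ)
    have h0 : ContDiff ℝ ∞ (fun z : ℝ × ℝ³ => z.2 0) :=
      (contDiff_piLp_apply (p := 2) (i := (0 : Fin 3))).comp contDiff_snd
    have h2 : ContDiff ℝ ∞ (fun z : ℝ × ℝ³ => z.2 2) :=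
      (contDiff_piLp_apply (p := 2) (i := (2 : Fin 3))).comp contDiff_snd
    exact (contDiff_const.mul ((h0.pow 2).add (h2.pow 2))).contDiffOn
  momentum t ht x := by
    have hderiv : timeDerivWithin (Ico 0 1) lineVel t x = (2 * Real.exp t * x 0) • ey := by
      rw [timeDerivWithin_apply]
      have hfun : (fun s => lineVel s x) = fun s => (x 0) • (-ex + (2 * Real.exp s) • ey) + (x 2) • ez :=
        funext fun s => linM_apply _ _
      rw [hfun]
      have h : HasDerivAt (fun s => (x 0) • (-ex + (2 * Real.exp s) • ey) + (x 2) • ez)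
          ((x 0) • ((2 * Real.exp t) • ey)) t :=
        ((((Real.hasDerivAt_exp t).const_mul 2).smul_const ey).const_add (-ex)).const_smul (x 0)
          |>.add_const ((x 2) • ez)
      rw [h.hasDerivWithinAt.derivWithin (uniqueDiffOn_Ico 0 1 t ht), smul_smul]
      ring_nf
    have hconv : convect (lineVel t) (lineVel t) x = (x 0) • (ex - (2 * Real.exp t) • ey) + (x 2) • ez := by
      rw [convect_apply, fderiv_lineVel, lineVel_eq, linM_linM]
    have hlap : (Δ (lineVel t)) x = 0 := by
      rw [lineVel_eq]
      exact laplacian_clm _ x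
    rw [hderiv, hconv, hlap, gradient_linePres]
    ext i
    fin_cases i
    · simp [ex, ey, ez]
    · simp [ex, ey, ez]
      ring
    · simp [ex, ey, ez]
  divFree t _ x := divergence_lineVel t x

/-! ## The slow class is a tube around the stagnation line: infinite volume -/

/-- For `t ≤ 1/2` the slow slice `{‖u(t)‖ ≤ 1}` contains the balls `B(n e₁, 1/8)`, `n ∈ ℕ`
(`‖u‖² = (1 + 4e^{2t})x₀² + x₂² ≤ 13/64 + 1/64 < 1` there, using `e ≤ 3`). [folklore] -/
theorem ball_subset_slowSlice {t : ℝ} (ht : t ∈ Icc (0 : ℝ) (1 / 2)) (n : ℕ) :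
    ball ((n : ℝ) • ey : ℝ³) (1 / 8) ⊆ {x : ℝ³ | ‖lineVel t x‖ ≤ 1} := by
  intro x hx
  rw [mem_ball, dist_eq_norm] at hx
  have h0 : |x 0| < 1 / 8 := by
    have h := PiLp.norm_apply_le (x - (n : ℝ) • ey) 0
    have hc : (x - (n : ℝ) • ey) 0 = x 0 := by simp [ey]
    rw [hc, Real.norm_eq_abs] at h
    exact lt_of_le_of_lt h hx
  have h2 : |x 2| < 1 / 8 := by
    have h := PiLp.norm_apply_le (x - (n : ℝ) • ey) 2
    have hc : (x - (n : ℝ) • ey) 2 = x 2 := by simp [ey]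
    rw [hc, Real.norm_eq_abs] at h
    exact lt_of_le_of_lt h hx
  have hexp : Real.exp t ^ 2 ≤ 3 := by
    have h1 : Real.exp t ^ 2 = Real.exp (2 * t) := by rw [← Real.exp_nat_mul]; norm_num
    rw [h1]
    have h2t : 2 * t ≤ 1 := by linarith [ht.2]
    have := Real.exp_le_exp.2 h2t
    have he : Real.exp 1 < 3 := lt_trans Real.exp_one_lt_d9 (by norm_num)
    linarith
  have hsq0 : (x 0) ^ 2 < (1 / 8) ^ 2 := by
    have := abs_lt.1 h0
    nlinarith
  have hsq2 : (x 2) ^ 2 < (1 / 8) ^ 2 := by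
    have := abs_lt.1 h2
    nlinarith
  have hle : ‖lineVel t x‖ ^ 2 ≤ 1 := by
    rw [norm_sq_lineVel]
    nlinarith [sq_nonneg (x 0), sq_nonneg (Real.exp t)]
  show ‖lineVel t x‖ ≤ 1
  exact (sq_le_one_iff₀ (norm_nonneg _)).1 hle

/-- The balls `B(n e₁, 1/8)`, `n ∈ ℕ`, are pairwise disjoint and congruent, so their union has infinite
volume. [folklore] -/
theorem volume_iUnion_ball_eq_top : volume (⋃ n : ℕ, ball ((n : ℝ) • ey : ℝ³) (1 / 8)) = ⊤ := by
  have hdisj : Pairwise (Function.onFun Disjoint fun n : ℕ => ball ((n : ℝ) • ey : ℝ³) (1 / 8)) := by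
    intro n m hnm
    apply ball_disjoint_ball
    rw [dist_eq_norm, ← sub_smul, norm_smul, Real.norm_eq_abs]
    have hey : ‖(ey : ℝ³)‖ = 1 := by simp [ey]
    rw [hey, mul_one]
    rcases lt_or_gt_of_ne hnm with h | h
    · have h' : (n : ℝ) + 1 ≤ m := by exact_mod_cast h
      rw [abs_sub_comm, abs_of_nonneg (by linarith)]
      linarith
    · have h' : (m : ℝ) + 1 ≤ n := by exact_mod_cast h
      rw [abs_of_nonneg (by linarith)]
      linarith
  rw [measure_iUnion hdisj fun n => measurableSet_ball]
  simp_rw [Measure.addHaar_ball_center volume]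
  exact ENNReal.tsum_const_eq_top_of_ne_zero (measure_ball_pos volume (0 : ℝ³) (by norm_num)).ne'

/-- **The slow space–time class of the witness has infinite volume**: for `0 < t ≤ 1/2`,
`|{(s, x) : 0 < s < t, ‖u(s, x)‖ ≤ 1}| = ∞` (it contains `(0, t) × ⋃ₙ B(n e₁, 1/8)`). [folklore] -/
theorem volume_slowClass_eq_top {t : ℝ} (ht : t ∈ Ioc (0 : ℝ) (1 / 2)) :
    volume {z : ℝ × ℝ³ | z.1 ∈ Ioo 0 t ∧ ‖lineVel z.1 z.2‖ ≤ 1} = ⊤ := by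
  have hsub : Ioo (0 : ℝ) t ×ˢ (⋃ n : ℕ, ball ((n : ℝ) • ey : ℝ³) (1 / 8)) ⊆
      {z : ℝ × ℝ³ | z.1 ∈ Ioo 0 t ∧ ‖lineVel z.1 z.2‖ ≤ 1} := by
    rintro ⟨s, x⟩ ⟨hs, hx⟩
    obtain ⟨n, hn⟩ := mem_iUnion.1 hx
    exact ⟨hs, ball_subset_slowSlice ⟨hs.1.le, hs.2.le.trans ht.2⟩ n hn⟩
  have hprod : volume (Ioo (0 : ℝ) t ×ˢ (⋃ n : ℕ, ball ((n : ℝ) • ey : ℝ³) (1 / 8))) = ⊤ := by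
    rw [Measure.volume_eq_prod, Measure.prod_prod, volume_iUnion_ball_eq_top, Real.volume_Ioo, sub_zero,
      ENNReal.mul_top (by simp [ht.1])]
  exact top_le_iff.1 (hprod ▸ measure_mono hsub)

/-! ## The crux without the energy class is false -/

/-- **The energy class is load-bearing for `SlowClassProduction`.** The crux
`HodographBetchov.SlowClassProduction` with its hypotheses `IsLerayHopfOn T ν 0 (u 0) u` and
`HasRapidSpatialDecay (u 0)` deleted — and nothing else changed — is FALSE: at `ν = T = l = 1` the
stagnation-line flow `u(t, x) = (−x₀, 2eᵗ x₀, x₂)` (`lineVel_isClassical`) has production density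
`ω·(∇u)ω ≡ 4e^{2t} ≥ 4` (`production_lineVel`) on a slow class of infinite space–time volume
(`volume_slowClass_eq_top`), so already the integrability half of the conclusion fails at `t = 1/2`.
No blow-up is involved (the flow is global and smooth); the mechanism is a STAGNATION LINE carrying vorticity
along the stretching axis — the "strained near-stagnant collar / degenerate stagnation line" of the item's
risk note, realised exactly. [cite: MajdaBertozzi2002, §1.4 (exact solutions with linear velocity field)] -/
theorem slowClassProduction_false_without_energyClass :
    ¬ (∀ (ν T : ℝ), 0 < ν → 0 < T → ∀ (u : ℝ → ℝ³ → ℝ³) (p : ℝ → ℝ³ → ℝ),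
        IsClassicalNSSolutionOn (Set.Ico 0 T) ν 0 u p → ∀ l : ℝ, 0 < l → ∃ C : ℝ, ∀ t ∈ Set.Ico 0 T,
          MeasureTheory.IntegrableOn (fun z : ℝ × ℝ³ =>
              inner ℝ (curl (u z.1) z.2) (fderiv ℝ (u z.1) z.2 (curl (u z.1) z.2)))
            {z : ℝ × ℝ³ | z.1 ∈ Set.Ioo 0 t ∧ ‖u z.1 z.2‖ ≤ l} ∧
          ∫ z in {z : ℝ × ℝ³ | z.1 ∈ Set.Ioo 0 t ∧ ‖u z.1 z.2‖ ≤ l},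
              inner ℝ (curl (u z.1) z.2) (fderiv ℝ (u z.1) z.2 (curl (u z.1) z.2)) ≤ C) := by
  intro h
  obtain ⟨C, hC⟩ := h 1 1 one_pos one_pos lineVel linePres (lineVel_isClassical 1) 1 one_pos
  obtain ⟨hint, -⟩ := hC (1 / 2) ⟨by norm_num, by norm_num⟩
  set D : Set (ℝ × ℝ³) := {z : ℝ × ℝ³ | z.1 ∈ Set.Ioo (0 : ℝ) (1 / 2) ∧ ‖lineVel z.1 z.2‖ ≤ 1} with hD
  -- `D` is measurable (the velocity is jointly continuous)
  have hcont : Continuous fun z : ℝ × ℝ³ => ‖lineVel z.1 z.2‖ := by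
    have hfun : (fun z : ℝ × ℝ³ => lineVel z.1 z.2) =
        fun z => (z.2 0) • (-ex + (2 * Real.exp z.1) • ey) + (z.2 2) • ez :=
      funext fun z => linM_apply _ _
    have hc : Continuous fun z : ℝ × ℝ³ => lineVel z.1 z.2 := by
      rw [hfun]
      fun_prop
    exact hc.norm
  have hDm : MeasurableSet D :=
    (measurableSet_Ioo.preimage measurable_fst).inter (measurableSet_le hcont.measurable measurable_const)
  -- the integrand is `≥ 4` on `D`
  have hP : ∀ z ∈ D, ENNReal.ofReal 4 ≤
      ‖inner ℝ (curl (lineVel z.1) z.2) (fderiv ℝ (lineVel z.1) z.2 (curl (lineVel z.1) z.2))‖ₑ := by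
    intro z hz
    rw [production_lineVel, Real.enorm_eq_ofReal (by positivity)]
    apply ENNReal.ofReal_le_ofReal
    have h1 : 1 ≤ Real.exp z.1 := Real.one_le_exp hz.1.1.le
    nlinarith
  have hlow : ENNReal.ofReal 4 * volume D ≤
      ∫⁻ z in D, ‖inner ℝ (curl (lineVel z.1) z.2) (fderiv ℝ (lineVel z.1) z.2 (curl (lineVel z.1) z.2))‖ₑ := by
    rw [← setLIntegral_const]
    exact setLIntegral_mono' hDm hP
  have hfin := hint.hasFiniteIntegral
  rw [hasFiniteIntegral_iff_enorm] at hfin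
  rw [hD, volume_slowClass_eq_top ⟨by norm_num, le_rfl⟩, ENNReal.mul_top (by simp)] at hlow
  exact absurd (lt_of_le_of_lt hlow hfin) (lt_irrefl _)

end Summit.NavierStokesRegularity.NavierStokesRegularity.Theorems.SlowClassProduction.Negative

end
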